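import Summits.ResolutionOfSingularities.ResolutionOfSingularities.Theorems.SoloBlindFrobeniusSandwich
import Literature.AlgebraicGeometry.Resolution.ComponentGluing
import HarnessLib
import HarnessLib.Audit.Tags

/-!
# Lemma C of the Frobenius-sandwich normal form: reduction to irreducible components

Kernel proof of the obligation node `SoloBlind.ComponentStep` of
`Theorems/SoloBlindFrobeniusSandwich.lean` (solo-blind line, Theorem A): over a field `k`,
resolution of INTEGRAL separated `k`-schemes of finite type implies resolution of REDUCED ones.

Proof. A reduced `k`-scheme of finite type is Noetherian, so it has finitely many irreducible
components; each, with its reduced closed-subscheme structure `(vanishingIdeal Z).subscheme`,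
is an integral closed subscheme, again separated and of finite type over `k` (compose the closed
immersion with the structure morphism), hence resolvable by hypothesis; the resolutions glue to
one of `X` (`C' ⨿ D' → X` is proper and birational along a closed cover with mutually dense
complements). All of this is the tree's `Literature.AlgebraicGeometry.Resolution.ComponentGluing`
(`hasResolution_of_forall_closeds`, Cossart–Piltant 2019, proof of Prop. 4.6, Step 1); this file
only instantiates it at the node's signature. With `SoloBlind.BaseStep_holds` and
`SoloBlind.ResolveStep_holds` this leaves `ExponentStep` and `QuotientStep` as the open
obligation nodes of `SoloBlind.SandwichReduction_holds`.

References: solo-blind notes `paper/paper.md`, §2 Lemma C; Cossart–Piltant 2019, proof of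
Prop. 4.6, Step 1 [CossartPiltant2019]; EGA IV₂ 7.9. [folklore]
-/

noncomputable section

open CategoryTheory AlgebraicGeometry TopologicalSpace
open Literature.AlgebraicGeometry.Resolution

namespace Summit.ResolutionOfSingularities.ResolutionOfSingularities.Theorems

universe u

/-- **Lemma C** (kernel): the obligation node `SoloBlind.ComponentStep` holds — over any field,
resolution of integral separated schemes of finite type gives resolution of reduced ones, by
resolving the irreducible components and gluing. [cite: CossartPiltant2019, proof of Prop. 4.6,
Step 1] -/
theorem SoloBlind.ComponentStep_holds : SoloBlind.ComponentStep.{u} := by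
  intro k _ hint X g hsep hft hqc hred
  refine ComponentGluing.hasResolution_of_forall_closeds X g fun Z hZ => ?_
  let ι := (Scheme.IdealSheafData.vanishingIdeal Z).subschemeι
  exact hint _ (ι ≫ g) inferInstance inferInstance inferInstance hZ

end Summit.ResolutionOfSingularities.ResolutionOfSingularities.Theorems

end
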